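import Literature.AlgebraicGeometry.Resolution.ValuedFunctionFields
import Mathlib.FieldTheory.IsSepClosed
import HarnessLib

/-!
# Knaf–Kuhlmann 2009, Thm. 1.1: the valuation-theoretic ingredients of its proof (§4.1)

Topic: `Literature/AlgebraicGeometry/Resolution`. The named fact `KnafKuhlmann2009_Thm12`
(`SmoothUniformization.lean`; Knaf–Kuhlmann 2009, Thm. 1.2: every place admits local
uniformization in a finite extension of the function field) is reduced in this topic
(`KnafKuhlmann2009_Thm12.of_parts'`, `KnafKuhlmann2009Prop23.lean`) to the two named facts
`KnafKuhlmann2009_Thm11` (Knaf–Kuhlmann 2009, Thm. 1.1) and `KnafKuhlmann2005_Thm11`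
(Knaf–Kuhlmann 2005, Thm. 1.1), both in `FiniteExtensionUniformization.lean`. The second is being
decomposed along Knaf–Kuhlmann 2005, §§3–5 (`AbhyankarRationalUniformization.lean` and its
sequels). This file opens the decomposition of the FIRST, along the printed proof of Thm. 1.1
(§4.1 of the paper, "Uniformization after a Galois extension", an induction on the transcendence
degree whose case `n = 1` rests on §§2.1, 3.3, 3.4 and whose induction step rests on §3.1), by
vendoring the two valuation-theoretic results the case `n = 1` imports:

* `IsImmediateOver V K F` — DEFINITION, "the valued extension `(F|K, P)` is immediate"
  (§2.1: `vF = vK` and `FP = KP`), in the ambient rendering of `ValuedFunctionFields.lean`.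
* `KnafKuhlmann2009_Lemma21` — NAMED FACT, Lemma 2.1 (= [K4], Lemma 2.16): for a non-trivial
  place `P` on `K^{sep}`, `v(K^{sep})` is the divisible hull of `vK` and `K^{sep}P` is the
  algebraic closure of `KP`.
* `KnafKuhlmann2009_Prop310_sepClosed` — NAMED FACT, Prop. 3.10 ("an immediate valued function
  field `(F|K, P)` of transcendence degree `1` with `F|K` separable over a separably tame
  `(K, P)` is strongly smoothly `O_K`-uniformizable") in the case of a separable-algebraically
  closed ground field `K` — the case `(K, P) = (K^{sep}, 𝒫)` in which §4.1 applies it ("Since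
  `(K^{sep}, 𝒫)` is a separably tame field, we can apply Proposition 3.10"). Prop. 3.10 is the
  deep input of Thm. 1.1: its printed proof is Thm. 3.8 (F.-V. Kuhlmann's *henselian
  rationality* of immediate function fields over tame fields, [K8]) + Kaplansky approximation
  (Lemmas 2.16, 2.17, 3.9) + the étale-local structure of smooth uniformizability (Lemma 3.7,
  Cor. 3.6).

Nothing is proved here beyond unfolding lemmas. The next layers (kept in the prover's notes):
the case `n = 1` of Thm. 1.1 from these two facts and Prop. 3.4 (2) (proved,
`FiniteExtensionUniformizationProofs.lean`); the ascent of a model along a finite separable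
extension of the base (the rôle of Prop. 3.3 in §4.1); the induction of §4.1, giving
`KnafKuhlmann2009_Thm11` from the two facts of this file.

## Sources

* [KK09] H. Knaf, F.-V. Kuhlmann, *Every place admits local uniformization in a finite extension
  of the function field*, Adv. Math. 221 (2009) 428–453 = arXiv:math/0702856 (theorem numbers
  agree): §1 ("The place `P` is called strongly (smoothly) `R`-uniformizable if all pairs
  `(P, Z)`, `Z ⊂ O_P` finite, are (smoothly) `R`-uniformizable"; "a valued field `(L, P)` is
  called separably tame if it is henselian and its separable algebraic closure `L^{sep}` equals
  the absolute ramification field of `(L, P)`"), §2.1 ("The valued extension `(L|K, P)` is called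
  immediate if `vL = vK` and `LP = KP`"; Lemma 2.1: "Let `K` be an arbitrary field and `P` a
  non-trivial place on `K^{sep}`. Then `v(K^{sep})` is the divisible hull `vK ⊗_ℤ ℚ` of `vK`, and
  `K^{sep}P` is the algebraic closure of `KP`. For a proof see [K4], Lemma 2.16."), §3.3
  (Prop. 3.10: "Let `(F|K, P)` be an immediate, valued function field of transcendence degree
  `1` and assume that `F|K` is separable and that `(K, P)` is separably tame. Then `P` is
  strongly smoothly `O_K`-uniformizable."), §4.1 (proof of Thm. 1.1, case `n = 1`: "Lemma 2.1
  implies that the extension `(E^{sep}|K^{sep}, 𝒫)` and hence also its subextension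
  `(E.K^{sep}|K^{sep}, 𝒫)` are immediate. Since `(K^{sep}, 𝒫)` is a separably tame field, we
  can apply Proposition 3.10 to see that `𝒫|_{E.K^{sep}}` is strongly smoothly
  `O_{K^{sep}}`-uniformizable.").
* [K4] F.-V. Kuhlmann, *Value groups, residue fields, and bad places of rational function
  fields*, Trans. Amer. Math. Soc. 356 (2004) 4559–4600, Lemma 2.16 (the reference of [KK09]
  for Lemma 2.1).
* [K8] F.-V. Kuhlmann, *Elimination of ramification II: Henselian rationality*, Israel J. Math.
  234 (2019) 927–958 (= [KK09]'s "[K8], in preparation"; the source of Thm. 3.8).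

## Rendering notes

* Ambient rendering as in `ValuedFunctionFields.lean`: one valued field `(Ω, V)`, fields are
  `Subfield Ω`, `O_E = V ∩ E`, values in `ValueGroup V`, residue fields `resField V E`.
* `K^{sep}`: Thm. 1.1 fixes an extension `𝒫` of `P` to `E^{sep}`; in the ambient rendering
  (`Ω` algebraically closed, as in `KnafKuhlmann2009_Thm11`) the separable closure of a subfield
  `K` is the subfield `L` of elements of `Ω` separable algebraic over `K`, i.e.
  `∀ x, x ∈ L ↔ IsSeparable K x` (Mathlib's `separableClosure K Ω`, which is a separable closure
  of `K` because `Ω` is separably closed: `separableClosure.isSepClosure`). Lemma 2.1 is stated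
  for such `K ≤ L ≤ Ω`.
* "`v(K^{sep})` is the divisible hull of `vK`" = every value of `Kˣ` has `n`-th roots in
  `v(K^{sep})` for every `n ≥ 1`, and `v(K^{sep})/vK` is torsion (`IsValueTorsionOver`);
  "`K^{sep}P` is the algebraic closure of `KP`" = `K^{sep}P | KP` is algebraic
  (`IsResiduallyAlgebraicOver`) and `K^{sep}P` is algebraically closed (`IsAlgClosed`).
  "Non-trivial place on `K^{sep}`" = some element of `K^{sep}` lies outside `V`.
* Prop. 3.10 is vendored only for `K` separable-algebraically closed (`IsSepClosed K`), a special
  case of "`(K, P)` separably tame" (such a `K` is henselian — its algebraic extensions are purely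
  inseparable, so `P` extends uniquely — and `K^{sep} = K` is its own absolute ramification
  field); this is the case used in §4.1 ([KK09] p. "Since `(K^{sep}, 𝒫)` is a separably tame
  field"). The general notion (absolute ramification field, henselian fields) is not rendered.
  "Valued function field of transcendence degree `1`" = `F|K` finitely generated with some
  `x ∈ F` transcendental over `K` and `F` algebraic over `K(x)`; "`F|K` separable" = separably
  generated (`SeparablyGeneratedOver`); "strongly smoothly `O_K`-uniformizable" = every finite
  `Z ⊆ O_P = V ∩ F` gives a smoothly `O_K`-uniformizable pair (`IsSmoothlyUniformizableIn` over
  the subring `V ∩ K`).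
* `IsImmediateOver V K F` records `vF ⊆ vK` and `FP ⊆ KP`; for `K ≤ F` (the only case used) the
  reverse inclusions are automatic, so this is `vF = vK ∧ FP = KP`.
-/

noncomputable section

namespace Literature.AlgebraicGeometry.Resolution

universe u

open IsLocalRing

variable {Ω : Type*} [Field Ω]

/-! ## Immediate extensions -/

/-- **Immediate valued extension** (Knaf–Kuhlmann 2009, §2.1: "The valued extension `(L|K, P)`
is called immediate if `vL = vK` and `LP = KP`"), ambient form for subfields `K ≤ F` of the
valued field `(Ω, V)`: every value of a non-zero element of `F` is the value of an element of
`K`, and every residue of an element of `V ∩ F` is the residue of an element of `V ∩ K` (the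
inclusions `vK ⊆ vF`, `KP ⊆ FP` being automatic for `K ≤ F`).
[cite: KnafKuhlmann2009, Section 2.1] -/
def IsImmediateOver (V : ValuationSubring Ω) (K F : Subfield Ω) : Prop :=
  (∀ a ∈ F, a ≠ 0 → ∃ b ∈ K, V.valuation a = V.valuation b) ∧ resField V F ≤ resField V K

/-! ## The named facts -/

/-- NAMED FACT — **Knaf–Kuhlmann 2009, Lemma 2.1** (= F.-V. Kuhlmann, *Value groups, residue
fields, and bad places of rational function fields*, Lemma 2.16): "Let `K` be an arbitrary field
and `P` a non-trivial place on `K^{sep}`. Then `v(K^{sep})` is the divisible hull `vK ⊗_ℤ ℚ` of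
`vK`, and `K^{sep}P` is the algebraic closure of `KP`." Rendering (module docstring): `K ≤ Ω`,
`Ω` algebraically closed with valuation ring `V`, `L ≤ Ω` the subfield of elements separable
algebraic over `K` (`= K^{sep}`), `P = V ∩ L` non-trivial; conclusion: `vK` is divisible inside
`vL`, `vL/vK` is torsion, `LP|KP` is algebraic and `LP` is algebraically closed. Users take
`(h : KnafKuhlmann2009_Lemma21)`. [cite: KnafKuhlmann2009, Lemma 2.1] -/
def KnafKuhlmann2009_Lemma21 : Prop :=
  ∀ (Ω : Type u) [Field Ω] [IsAlgClosed Ω] (V : ValuationSubring Ω) (K L : Subfield Ω),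
    (∀ x : Ω, x ∈ L ↔ IsSeparable K x) → (∃ a ∈ L, a ∉ V) →
    (∀ b ∈ K, b ≠ 0 → ∀ n : ℕ, n ≠ 0 → ∃ a ∈ L, V.valuation (a ^ n) = V.valuation b) ∧
    IsValueTorsionOver V K L ∧ IsResiduallyAlgebraicOver V K L ∧ IsAlgClosed (resField V L)

/-- NAMED FACT — **Knaf–Kuhlmann 2009, Prop. 3.10, over a separable-algebraically closed ground
field**: "Let `(F|K, P)` be an immediate, valued function field of transcendence degree `1` and
assume that `F|K` is separable and that `(K, P)` is separably tame. Then `P` is strongly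
smoothly `O_K`-uniformizable." Vendored in the case `K` separable-algebraically closed (a
separably tame valued field for every `P`; the case `(K^{sep}, 𝒫)` to which §4.1 of the paper
applies the proposition — see the module docstring); rendering: `K ≤ F ≤ Ω`, `F|K` finitely
generated, separably generated, of transcendence degree `1` (`x ∈ F` transcendental over `K`
with `F|K(x)` algebraic), `(F|K, V)` immediate; conclusion: for every finite `Z ⊆ V ∩ F` the pair
`(V ∩ F, Z)` is smoothly `(V ∩ K)`-uniformizable. Users take
`(h : KnafKuhlmann2009_Prop310_sepClosed)`. [cite: KnafKuhlmann2009, Prop. 3.10] -/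
def KnafKuhlmann2009_Prop310_sepClosed : Prop :=
  ∀ (Ω : Type u) [Field Ω] (V : ValuationSubring Ω) (K F : Subfield Ω), IsSepClosed K →
    K ≤ F → FGOver K F → SeparablyGeneratedOver K F →
    (∃ x ∈ F, Transcendental K x ∧
      ∀ z ∈ F, IsAlgebraic (IntermediateField.adjoin K ({x} : Set Ω)) z) →
    IsImmediateOver V K F →
    ∀ Z : Finset Ω, (∀ z ∈ Z, z ∈ V ∧ z ∈ F) →
      IsSmoothlyUniformizableIn ↥(V.toSubring ⊓ K.toSubring) V F (Z : Set Ω)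

/-! ## API -/

/-- An extension is immediate over itself. [folklore] -/
theorem IsImmediateOver.refl (V : ValuationSubring Ω) (K : Subfield Ω) : IsImmediateOver V K K :=
  ⟨fun a ha _ => ⟨a, ha, rfl⟩, le_rfl⟩

/-- An immediate extension has torsion (indeed trivial) value group quotient `vF/vK`.
[folklore] -/
theorem IsImmediateOver.isValueTorsionOver {V : ValuationSubring Ω} {K F : Subfield Ω}
    (h : IsImmediateOver V K F) : IsValueTorsionOver V K F := by
  intro a ha ha0
  obtain ⟨b, hb, hab⟩ := h.1 a ha ha0
  exact ⟨1, one_ne_zero, b, hb, by rw [pow_one, hab]⟩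

/-- An immediate extension has algebraic (indeed trivial) residue field extension `FP|KP`.
[folklore] -/
theorem IsImmediateOver.isResiduallyAlgebraicOver {V : ValuationSubring Ω} {K F : Subfield Ω}
    (h : IsImmediateOver V K F) : IsResiduallyAlgebraicOver V K F :=
  fun r hr => isAlgebraic_algebraMap (⟨r, h.2 hr⟩ : resField V K)

/-- Immediateness is transitive in towers `K ≤ F ≤ L`. [folklore] -/
theorem IsImmediateOver.trans {V : ValuationSubring Ω} {K F L : Subfield Ω}
    (hKF : IsImmediateOver V K F) (hFL : IsImmediateOver V F L) : IsImmediateOver V K L := by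
  refine ⟨fun a ha ha0 => ?_, hFL.2.trans hKF.2⟩
  obtain ⟨b, hb, hab⟩ := hFL.1 a ha ha0
  by_cases hb0 : b = 0
  · exact ⟨0, K.zero_mem, by rw [hab, hb0]⟩
  obtain ⟨c, hc, hbc⟩ := hKF.1 b hb hb0
  exact ⟨c, hc, hab.trans hbc⟩

/-- A subextension `K ≤ F ≤ L` of an immediate extension `L|K` is immediate over `K`.
[folklore] -/
theorem IsImmediateOver.mono_right {V : ValuationSubring Ω} {K F L : Subfield Ω} (hFL : F ≤ L)
    (h : IsImmediateOver V K L) : IsImmediateOver V K F :=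
  ⟨fun a ha ha0 => h.1 a (hFL ha) ha0, (resField_mono V hFL).trans h.2⟩

/-- Prop. 3.10 with `Z = ∅`: the place of an immediate separable function field of
transcendence degree `1` over a separable-algebraically closed `K` is smoothly
`O_K`-uniformizable. [folklore] -/
theorem KnafKuhlmann2009_Prop310_sepClosed.isSmoothlyUniformizableIn
    (h : KnafKuhlmann2009_Prop310_sepClosed.{u}) (Ω : Type u) [Field Ω] (V : ValuationSubring Ω)
    (K F : Subfield Ω) [IsSepClosed K] (hKF : K ≤ F) (hfg : FGOver K F)
    (hsep : SeparablyGeneratedOver K F)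
    (h1 : ∃ x ∈ F, Transcendental K x ∧
      ∀ z ∈ F, IsAlgebraic (IntermediateField.adjoin K ({x} : Set Ω)) z)
    (himm : IsImmediateOver V K F) :
    IsSmoothlyUniformizableIn ↥(V.toSubring ⊓ K.toSubring) V F ∅ := by
  simpa using h Ω V K F ‹_› hKF hfg hsep h1 himm ∅ (by simp)

end Literature.AlgebraicGeometry.Resolution

end
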